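import Literature.AnabelianGeometry.AbsoluteAnabelian.AbsTopII.DehnTwistLoopProp13ii
import Literature.AnabelianGeometry.AbsoluteAnabelian.AbsTopII.DehnTwistDecompositionGroups
import HarnessLib

/-!
# [AbsTopII] Prop 1.3 (iii) at the NODAL model: the cusp clause `D_c ∩ Π_I = I_c × I_v`, unconditionally

S. Mochizuki, *Topics in Absolute Anabelian Geometry II* [AbsTopII] (bib `MochizukiAbsTopII2013`; locators =
PDF pages of the kurims manuscript `paper:url-585b8d0ad0d9`), §1, Prop 1.3 (iii) p. 11: "If `e` is a cusp that
abuts to `v`, then [for appropriate choices of conjugates] `I_e, I_v ⊆ D_e`, and the natural morphism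
`I_e × I_v → D_e ∩ Π_I` is an isomorphism"; Def 1.2 (ii) p. 10 (`D_e := N_{Π_H}(Π_e)`, `I_e := Π_e` for a cusp).

PROOF-ONLY assembly (no definition), abc-iut-L4-t6 lineage, row «DPSC-NODAL-MODEL»: at the nodal Dehn-twist
datum `dpsc i hi` the cusp group is `Π_c × 1 = ⟨aba⁻¹b⁻¹⟩^ × 1 ⊆ F̂₂ ⋊ Ẑ`.  abc-iut-f-069's
`DehnTwistDecompositionGroups` (p459741) computed `D_c = N_{Π_I}(Π_c × 1) = (Π_c × 1) · (1 ⋊ Ẑ)`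
(`normalizer_map_inl_cuspGp_eq`; the twist fixes `Π_c`, `shearPow_mem_cuspGp`) — consumed BY NAME; this file
adds the (iii)-shaped reading and the transfer to the `DPSCIndexData` vocabulary:

* `cusp_clause_ext` — `IsInternalProduct (Π_c × 1) (conj 1 • (1 ⋊ Ẑ)) (D_c ∩ Π_I)`,
  `(D_c ∩ Π_I) ∩ Π_𝔾 = Π_c × 1`, `(D_c ∩ Π_I) · Π_𝔾 = Π_I`, in `Π_I = Ext i`;
* **`prop_1_3_iii_cusp_dpsc_holds`** — the CUSP conjunct of the typed `Prop_1_3_iii''` (Π_𝔾-scope, `γ = 1`)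
  and (`prop_1_3_iii'_cusp_dpsc_holds`) of `Prop_1_3_iii'` HOLDS at `dpsc i hi`, NON-IDLY (there is a cusp;
  `I_v = Ẑ ≠ 1`), with no hypothesis.
The VERTEX conjunct of (iii′)/(iii″) (`D_v ∩ Π_I = I_v × Π_v`) needs `N_{F̂₂}(Π_v) = Π_v` for the rank-2
closed subgroup `Π_v = ⟨b, aba⁻¹⟩^` — not in the tree; not claimed here.  HONEST FRAMING: classical profinite
group theory in a constructed model (constructed ≠ geometric); typed ≠ proved; nothing here bears on
[IUTchIII] Cor 3.12.
-/

noncomputable section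

open scoped Pointwise

namespace Literature.AnabelianGeometry.AbsoluteAnabelian.AbsTopII.DehnTwist

open Literature.AnabelianGeometry.EtaleTheta.SettingModel

variable (i : ℕ)

/-- `1 ⋊ Ẑ` centralises `Π_c × 1` (the twist fixes `Π_c` pointwise). [cite: MochizukiAbsTopII2013, Prop 1.3 (iii) p.11] -/
theorem inr_mem_centralizer_cusp (k : ZH) :
    (SemidirectProduct.inr k : Ext i) ∈
      Subgroup.centralizer ((cuspGp.map (SemidirectProduct.inl : F₂hatT →* Ext i) : Subgroup (Ext i)) :
        Set (Ext i)) := by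
  rw [mem_centralizer_map_inl_iff i (shearPow_mem_cuspGp i), SemidirectProduct.left_inr]
  exact Subgroup.one_mem _

/-- **The cusp clause of Prop 1.3 (iii) in `Π_I = Ext i`**: `D_c ∩ Π_I` is the internal direct product of
`I_c = Π_c × 1` and `I_v = 1 ⋊ Ẑ` (written `conj(1) • (1 ⋊ Ẑ)`), `(D_c ∩ Π_I) ∩ Π_𝔾 = I_c`, and
`(D_c ∩ Π_I) · Π_𝔾 = Π_I`. [cite: MochizukiAbsTopII2013, Prop 1.3 (iii) p.11] -/
theorem cusp_clause_ext :
    IsInternalProduct (cuspGp.map (SemidirectProduct.inl : F₂hatT →* Ext i))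
        (MulAut.conj (1 : Ext i) • (SemidirectProduct.inr : ZH →* Ext i).range)
        (Subgroup.normalizer ((cuspGp.map (SemidirectProduct.inl : F₂hatT →* Ext i) : Subgroup (Ext i)) :
          Set (Ext i)) ⊓ (⊤ : Subgroup (Ext i))) ∧
      (Subgroup.normalizer ((cuspGp.map (SemidirectProduct.inl : F₂hatT →* Ext i) : Subgroup (Ext i)) :
          Set (Ext i)) ⊓ (⊤ : Subgroup (Ext i))) ⊓ (SemidirectProduct.inl : F₂hatT →* Ext i).range =
        cuspGp.map (SemidirectProduct.inl : F₂hatT →* Ext i) ∧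
      (Subgroup.normalizer ((cuspGp.map (SemidirectProduct.inl : F₂hatT →* Ext i) : Subgroup (Ext i)) :
          Set (Ext i)) ⊓ (⊤ : Subgroup (Ext i))) ⊔ (SemidirectProduct.inl : F₂hatT →* Ext i).range = ⊤ := by
  rw [normalizer_map_inl_cuspGp_eq, inf_top_eq, map_one, one_smul]
  refine ⟨⟨le_sup_left, le_sup_right, ?_, ?_, rfl⟩, ?_, ?_⟩
  · rintro a ha _ ⟨k, rfl⟩
    exact Subgroup.mem_centralizer_iff.mp (inr_mem_centralizer_cusp i k) a ha
  · rw [eq_bot_iff]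
    rintro g ⟨⟨n, -, hng⟩, ⟨k, rfl⟩⟩
    have h := congrArg SemidirectProduct.right hng
    rw [SemidirectProduct.right_inl, SemidirectProduct.right_inr] at h
    rw [Subgroup.mem_bot, ← h, map_one]
  · apply le_antisymm
    · intro g hg
      rw [Subgroup.mem_inf] at hg
      obtain ⟨hg, n, rfl⟩ := hg
      rw [mem_map_inl_sup_range_inr_iff (shearPow_mem_cuspGp_of_mem i), SemidirectProduct.left_inl] at hg
      exact ⟨n, hg, rfl⟩
    · exact le_inf le_sup_left (fun _ ⟨n, _, h⟩ => ⟨n, h⟩)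
  · exact top_le_iff.mp ((range_inr_sup_range_inl i).symm.le.trans (sup_le_sup_right le_sup_right _))

/-! ### At the DPSC datum `dpsc i hi` -/

section Dpsc

variable {i} (hi : 0 < i)

/-- `I_c = Π_c × 1` (`rfl`). [cite: MochizukiAbsTopII2013, Def 1.2 (ii) p.10] -/
theorem dpsc_IvCusp (e : (dpsc i hi).Cusp) :
    (dpsc i hi).IvCusp e = cuspGp.map (SemidirectProduct.inl : F₂hatT →* Ext i) := rfl

/-- `D_c = N_{Π_I}(Π_c × 1)` (`rfl`). [cite: MochizukiAbsTopII2013, Def 1.2 (ii) p.10] -/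
theorem dpsc_DvCusp (e : (dpsc i hi).Cusp) :
    (dpsc i hi).DvCusp e =
      Subgroup.normalizer ((cuspGp.map (SemidirectProduct.inl : F₂hatT →* Ext i) : Subgroup (Ext i)) :
        Set (Ext i)) := rfl

/-- **[AbsTopII] Prop 1.3 (iii), CUSP clause — in the Π_𝔾-scope form of the typed `Prop_1_3_iii''` (`γ = 1 ∈ Π_𝔾`)
— HOLDS at the nodal Dehn-twist datum `dpsc i hi`, non-idly, with no hypothesis**: `D_c ∩ Π_I = I_c × I_v`,
`(D_c ∩ Π_I) ∩ Π_𝔾 = I_c`, `(D_c ∩ Π_I) · Π_𝔾 = Π_I`. [cite: MochizukiAbsTopII2013, Prop 1.3 (iii) p.11] -/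
theorem prop_1_3_iii_cusp_dpsc_holds (e : (dpsc i hi).Cusp) :
    ∃ γ : (dpsc i hi).PiH, γ ∈ (dpsc i hi).PiG ∧
      IsInternalProduct ((dpsc i hi).IvCusp e) (MulAut.conj γ • (dpsc i hi).Iv ((dpsc i hi).cuspVert e))
        ((dpsc i hi).DvCusp e ⊓ (dpsc i hi).PiI) ∧
      ((dpsc i hi).DvCusp e ⊓ (dpsc i hi).PiI) ⊓ (dpsc i hi).PiG = (dpsc i hi).IvCusp e ∧
      ((dpsc i hi).DvCusp e ⊓ (dpsc i hi).PiI) ⊔ (dpsc i hi).PiG = (dpsc i hi).PiI := by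
  refine ⟨1, Subgroup.one_mem _, ?_⟩
  rw [Iv_dpsc_eq_range_inr_holds hi]
  exact cusp_clause_ext i

/-- The same in the `∃ g : Π_H` form of the typed `Prop_1_3_iii'` (cusp conjunct).
[cite: MochizukiAbsTopII2013, Prop 1.3 (iii) p.11] -/
theorem prop_1_3_iii'_cusp_dpsc_holds (e : (dpsc i hi).Cusp) :
    ∃ g : (dpsc i hi).PiH,
      IsInternalProduct ((dpsc i hi).IvCusp e) (MulAut.conj g • (dpsc i hi).Iv ((dpsc i hi).cuspVert e))
        ((dpsc i hi).DvCusp e ⊓ (dpsc i hi).PiI) ∧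
      ((dpsc i hi).DvCusp e ⊓ (dpsc i hi).PiI) ⊓ (dpsc i hi).PiG = (dpsc i hi).IvCusp e ∧
      ((dpsc i hi).DvCusp e ⊓ (dpsc i hi).PiI) ⊔ (dpsc i hi).PiG = (dpsc i hi).PiI := by
  obtain ⟨γ, -, h⟩ := prop_1_3_iii_cusp_dpsc_holds hi e
  exact ⟨γ, h⟩

end Dpsc

end Literature.AnabelianGeometry.AbsoluteAnabelian.AbsTopII.DehnTwist

end
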